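import Literature.Barriers.SmoothPoincare4.ExoticOpenFourSpacePolarNhdProofs
import Mathlib.Topology.UrysohnsLemma
import Mathlib.Topology.Algebra.InfiniteSum.NatInt
import Mathlib.Topology.Algebra.InfiniteSum.Order
import Mathlib.Topology.Algebra.InfiniteSum.Real
import HarnessLib

/-!
# `deMichelisFreedman1992_continuum`: the end-periodic end of §0/§2 produced by a diffeomorphism `(R⁴_s, K) ≅ (R⁴_t, K)` — the topological skeleton of the first paragraph of the proof of Thm. 4.1

Proof file (theorems only; sibling of `ExoticOpenFourSpaceProofs`, `ExoticOpenFourSpaceEmbeddingProofs`,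
`ExoticOpenFourSpacePolarProofs`, `ExoticOpenFourSpacePolarNhdProofs`) for the named fact
`Literature.Barriers.SmoothPoincare4.deMichelisFreedman1992_continuum` (DeMichelis–Freedman 1992,
Thm. 4.1 with Cor. 4.1: continuum many pairwise non-diffeomorphic open subsets of standard `ℝ⁴`,
each homeomorphic to `ℝ⁴`).

The siblings prove the second and third paragraphs of the printed proof of Thm. 4.1 (p. 247),
the proof of Cor. 4.1 (p. 248) and the shape of the polar family (the sentence on p. 248 deriving
the last assertion of Thm. 4.1 from the Schoenflies theorem does not enter the fact), and reduce
the discharge `deMichelisFreedman1992_continuum_holds` to the first paragraph in its weakest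
printed form (`deMichelisFreedman1992_continuum_of_polar_nhdNogo`, or the on-`K`
form `deMichelisFreedman1992_continuum_of_polar_nogo`): for the polar family
`R⁴_t = polarBall R e t` of ONE open `ℝ⁴`-homeomorph `R ⊆ ℝ⁴` with compactum `K ⊂ R⁴_0`, no
diffeomorphism `d : R⁴_s ≅ R⁴_t`, `s < t ∈ CS`, is the identity near (resp. on) `K`. The first
paragraph (p. 247) derives this from gauge theory in two moves: "Suppose there is a
diffeomorphism `(d, id_K) : (R⁴_s, K) → (R⁴_t, K)`, `s ≠ t ∈ CS`. As in the introduction, this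
allows the construction of end periodic metrics: `B_∞` isometric to `Q_∞`. This leads via
Theorem 2.1 to a contradiction". THIS FILE formalizes the topological content of the first move —
the END-PERIODIC END that such a diffeomorphism produces (§0, p. 220; §2, pp. 222–223) — as
proved theorems; the Riemannian metrics `B_n`, `Q_n`, `M_∞` on it, the `Φ`-invariant and
Thm. 2.1 (the second move) remain the theory absent from Mathlib, and no named fact is introduced
(D-0026).

The source, §0 (p. 220): "Suppose two pairs `(R⁴_s, K)`, `(R⁴_t, K)`, `s < t`, are diffeomorphic
relative to the identity on `K` … Then `R⁴_t ∖ ⋂_{n ≥ 1} dⁿ(R⁴_t)` has a 'covering' action by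
the monoid `{d, d², d³, …}`; the quotient `Y` is a smooth manifold. Giving `Y` some Riemannian
metric, it is easy to alter the Riemannian metric on `B` and `Q` so that `n` consecutive rings
`R⁴ ∖ dⁿ(R⁴)` cover `Y` isometrically. … noncompact end periodic manifolds `B_∞` and `Q_∞` which
are simply Riemannian structures on `B ∖ inc₁(⋂ₙ dⁿ(R⁴_t))` and `Q ∖ …`"; §2 (pp. 222–223):
"Suppose there is an open submanifold `R'⁴` contained in a compact submanifold of `R⁴`,
`R'⁴ ⊂ C ⊂ R⁴`, and a diffeomorphism `d : R⁴ → R'⁴`. Then define `R⁴_k = d^{k-1} R⁴_1`. The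
quotient `Y = (R⁴ ∖ ⋂_{k ≥ 1} R⁴_k)/pt ∼ d(pt)` has a natural smooth structure, which can be
described as `C ∖ d(C)/pt ∼ d(pt)`. … To do elliptic analysis on `M_∞`, Taubes [24] suggests
introducing a proper function `τ : M_∞ → ℝ₊` such that `τ(d(x)) = 1 + τ(x)` for all
`x ∈ R⁴_1`." Here the source's `d` maps the larger ball into itself onto the smaller one; for the
tree's `d : R⁴_s ≅ R⁴_t` (`s < t`, so `R⁴_s ⊆ R⁴_t`) it is the self-map
`σ = incl ∘ d⁻¹ : R⁴_t → R⁴_s ⊆ R⁴_t`.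

Results (all PROVED). Abstract part, namespace `EndPeriodic`, for a self-map `σ : X → X` with
`range σ ⊆ C` (`X` = `R⁴`, `σ` = `d`, `C` compact as in §2; `R⁴_k = range σ^[k]`):
* `EndPeriodic.antitone_range_iterate`, `range_iterate_succ_subset_image` — the `R⁴_k` are nested,
  `R⁴_{k+1} ⊆ σ^[k](C) ⊆ R⁴_k`;
* `EndPeriodic.iInter_range_iterate_eq`, `isCompact_iInter_range_iterate`,
  `image_iInter_range_iterate`, `mem_iInter_range_iterate_of_apply_eq` — the end compactum
  `⋂ₖ R⁴_k = ⋂ₖ σ^[k](C)` (the set deleted from `B`, `Q` to form `B_∞`, `Q_∞`) is compact,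
  `σ`-invariant, and contains every fixed point of `σ` (so `⊇ K` when `σ = id` on `K`);
* `EndPeriodic.existsUnique_iterate_apply_eq`, `compl_iInter_range_iterate_eq_iUnion`,
  `image_iterate_compl_range`, `disjoint_ring` — the "covering action by the monoid": off the end
  compactum every point is `σ^[k] y` for a unique `k` and a unique `y` in the fundamental domain
  `X ∖ σ(X)`, i.e. the rings `R⁴_k ∖ R⁴_{k+1} = σ^[k](X ∖ σ(X))` partition the complement of the
  end compactum;
* `EndPeriodic.existsUnique_mem_diff_image` — "`Y` can be described as `C ∖ d(C)/pt ∼ d(pt)`":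
  every orbit off the end compactum meets `C ∖ σ(C)` exactly once;
  `EndPeriodic.isCompact_diff_range_iterate_two`, `diff_image_subset_diff_range_iterate_two`,
  `diff_range_iterate_two_subset_compl` — and `C ∖ σ(C)` lies in the compact subset
  `C ∖ σ²(X)` of the complement of the end compactum (so the orbit space `Y` is the continuous
  image of a compact set);
* `EndPeriodic.exists_height_function` — Taubes' function: for `σ` an open embedding of a locally
  compact Hausdorff space with `range σ ⊆ C` compact there is `τ ≥ 0`, continuous off the end
  compactum, with `τ (σ x) = τ x + 1` there and `k ≤ τ ≤ k + 1` on the ring `R⁴_k ∖ R⁴_{k+1}`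
  (so `τ → ∞` exactly towards the end compactum); `τ = Σₖ ρₖ` for the push-forwards `ρₖ` along
  `σ^[k]`, extended by zero, of a compactly supported `ρ ≡ 1` on `C`.
Polar part (the tree's setting, any finite-dimensional real normed space `E` in place of `ℝ⁴`):
* `isCompact_setOf_mul_norm_le`, `setOf_mul_norm_le_subset_polarBall` — the closed polar ball
  `{(1 - s) ‖e ·‖ ≤ 1}` is a compact subset of `R⁴_t` for `s < t`, `s < 1` (the `C` of §2);
* `isOpenEmbedding_inclusion_comp_symm`, `contMDiff_inclusion_comp_symm`,
  `range_inclusion_comp_symm`, `inclusion_comp_symm_apply_of_apply_eq` — for a diffeomorphism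
  `d : R⁴_s ≅ R⁴_t`, `s ≤ t`, the self-map `σ = incl ∘ d⁻¹` of `R⁴_t` is a smooth open
  embedding with image `R⁴_s`, fixing every point of `K` that `d` fixes;
* `exists_endPeriodicEnd_of_diffeomorph` (and `…_cantorSet` for parameters `s < t` in `CS`) —
  summary: a diffeomorphism `(R⁴_s, K) → (R⁴_t, K)` relative to the identity on `K`, `s < t`,
  yields the end-periodic end of §0/§2 inside `R⁴_t`: smooth open self-embedding `σ` with image
  `R⁴_s`, compact `σ`-invariant end compactum `⋂ₖ σ^[k](R⁴_t) ⊇ K`, rings with unique normal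
  form, compact fundamental domain, and Taubes' height function `τ`.

NOT rendered (absent from Mathlib): the smooth structure on the orbit space `Y` and the gluing
of the end to `B ∖ K`, `Q ∖ K` (quotients and gluings of manifolds), the end-periodic metrics
`B_n`, `Q_n`, `B_∞ ≅ Q_∞`, and everything about `Φ` (§1, Thm. 2.1, App. A, B).

## References

* S. DeMichelis, M. H. Freedman, *Uncountably many exotic `R⁴`'s in standard 4-space*,
  J. Differential Geom. 35 (1992) 219–254: §0 (p. 220), §2 (pp. 222–223), proof of Thm. 4.1
  (p. 247) [DeMichelisFreedman1992].
* C. H. Taubes, *Gauge theory on asymptotically periodic 4-manifolds*, J. Differential Geom. 25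
  (1987) 363–430: Def. 1.2 (p. 365, end-periodic manifolds built from a fundamental segment);
  the source's reference [24] for the function `τ` [Taubes1987].

[DeMichelisFreedman1992] [Taubes1987]
-/

noncomputable section

open scoped Manifold ContDiff Topology
open TopologicalSpace Set Function Filter Topology

namespace Literature.Barriers.SmoothPoincare4

/-! ### The end generated by a self-map with relatively compact image (§2, pp. 222–223) -/

namespace EndPeriodic

variable {X : Type*} {σ : X → X} {C : Set X}

/-! #### The nested sets `R⁴_k = σ^[k](X)` -/

/-- `σ^[k+1](X) = σ^[k](σ(X))`. [folklore] -/
theorem range_iterate_succ_eq (σ : X → X) (k : ℕ) :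
    range (σ^[k + 1]) = σ^[k] '' range σ := by
  rw [Function.iterate_succ, Set.range_comp]

/-- `R⁴_{k+1} ⊆ σ^[k](C)` when `σ(X) ⊆ C` ("`R'⁴ ⊂ C ⊂ R⁴`", §2).
[cite: DeMichelisFreedman1992, §2 (pp. 222–223)] -/
theorem range_iterate_succ_subset_image (hσC : range σ ⊆ C) (k : ℕ) :
    range (σ^[k + 1]) ⊆ σ^[k] '' C := by
  rw [range_iterate_succ_eq]
  exact image_mono hσC

/-- **The sets `R⁴_k = σ^[k](X)` are nested** ("define `R⁴_k = d^{k-1} R⁴_1`", §2; the nested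
`dⁿ(R⁴_t)` of §0). [cite: DeMichelisFreedman1992, §0 (p. 220), §2 (p. 223)] -/
theorem antitone_range_iterate (σ : X → X) : Antitone fun k => range (σ^[k]) := by
  refine antitone_nat_of_succ_le fun k => ?_
  show range (σ^[k + 1]) ⊆ range (σ^[k])
  rw [range_iterate_succ_eq]
  exact image_subset_range _ _

/-- The sets `σ^[k](C)` are nested as well. [cite: DeMichelisFreedman1992, §2 (pp. 222–223)] -/
theorem antitone_image_iterate (hσC : range σ ⊆ C) : Antitone fun k => σ^[k] '' C := by
  refine antitone_nat_of_succ_le fun k => ?_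
  show σ^[k + 1] '' C ⊆ σ^[k] '' C
  exact (image_subset_range _ _).trans (range_iterate_succ_subset_image hσC k)

/-- `C` is forward invariant: `σ^[k](C) ⊆ C`. [folklore] -/
theorem iterate_mem_of_mem (hσC : range σ ⊆ C) {y : X} (hy : y ∈ C) : ∀ k, σ^[k] y ∈ C
  | 0 => hy
  | k + 1 => by
    rw [Function.iterate_succ_apply']
    exact hσC ⟨_, rfl⟩

/-! #### The end compactum `⋂ₖ R⁴_k` -/

/-- **The end compactum**: `⋂ₖ σ^[k](X) = ⋂ₖ σ^[k](C)` (the set `⋂ₙ dⁿ(R⁴_t)` deleted from `B`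
and `Q` to form `B_∞`, `Q_∞`, §0; `⋂ₖ R⁴_k`, §2). [cite: DeMichelisFreedman1992, §0 (p. 220), §2 (p. 223)] -/
theorem iInter_range_iterate_eq (hσC : range σ ⊆ C) :
    (⋂ k, range (σ^[k])) = ⋂ k, σ^[k] '' C := by
  apply Subset.antisymm
  · exact subset_iInter fun k =>
      (iInter_subset _ (k + 1)).trans (range_iterate_succ_subset_image hσC k)
  · exact iInter_mono fun k => image_subset_range _ _

/-- Fixed points of `σ` lie in the end compactum; in particular so does `K` when `σ` is the
identity on `K` ("diffeomorphic relative to the identity on `K`", §0).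
[cite: DeMichelisFreedman1992, §0 (p. 220)] -/
theorem mem_iInter_range_iterate_of_apply_eq {x : X} (hx : σ x = x) :
    x ∈ ⋂ k, range (σ^[k]) :=
  mem_iInter.2 fun k => ⟨x, Function.iterate_fixed hx k⟩

/-- `σ⁻¹(end compactum) ⊆ end compactum` for injective `σ`. [folklore] -/
theorem mem_iInter_range_iterate_of_apply_mem (hinj : Injective σ) {x : X}
    (hx : σ x ∈ ⋂ k, range (σ^[k])) : x ∈ ⋂ k, range (σ^[k]) := by
  refine mem_iInter.2 fun k => ?_
  obtain ⟨y, hy⟩ := mem_iInter.1 hx (k + 1)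
  rw [Function.iterate_succ_apply'] at hy
  exact ⟨y, hinj hy⟩

/-- The end compactum is forward invariant under every iterate. [folklore] -/
theorem iterate_apply_mem_iInter_range_iterate {x : X} (hx : x ∈ ⋂ k, range (σ^[k])) (n : ℕ) :
    σ^[n] x ∈ ⋂ k, range (σ^[k]) := by
  refine mem_iInter.2 fun k => ?_
  obtain ⟨y, rfl⟩ := mem_iInter.1 hx k
  exact ⟨σ^[n] y, by rw [← Function.iterate_add_apply, add_comm, Function.iterate_add_apply]⟩

/-- `σ x` lies in the end compactum iff `x` does (`σ` injective). [folklore] -/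
theorem apply_mem_iInter_range_iterate_iff (hinj : Injective σ) {x : X} :
    σ x ∈ ⋂ k, range (σ^[k]) ↔ x ∈ ⋂ k, range (σ^[k]) :=
  ⟨mem_iInter_range_iterate_of_apply_mem hinj,
    fun hx => iterate_apply_mem_iInter_range_iterate hx 1⟩

/-- **The end compactum is `σ`-invariant**: `σ(⋂ₖ R⁴_k) = ⋂ₖ R⁴_k` (`σ` injective), so `σ`
restricts to a self-map of its complement — the "covering action" of §0 lives on
`R⁴_t ∖ ⋂ₙ dⁿ(R⁴_t)`. [cite: DeMichelisFreedman1992, §0 (p. 220)] -/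
theorem image_iInter_range_iterate (hinj : Injective σ) :
    σ '' (⋂ k, range (σ^[k])) = ⋂ k, range (σ^[k]) := by
  apply Subset.antisymm
  · rintro _ ⟨x, hx, rfl⟩
    exact iterate_apply_mem_iInter_range_iterate hx 1
  · intro x hx
    obtain ⟨y, rfl⟩ := mem_iInter.1 hx 1
    exact ⟨y, mem_iInter_range_iterate_of_apply_mem hinj hx, rfl⟩

/-! #### The covering action by the monoid `{σ, σ², …}`: fundamental domains and rings -/

/-- **Normal form off the end compactum** ("`R⁴_t ∖ ⋂ₙ dⁿ(R⁴_t)` has a 'covering' action by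
the monoid `{d, d², d³, …}`", §0; "`Y = (R⁴ ∖ ⋂ R⁴_k)/pt ∼ d(pt)`", §2): for `σ` injective, every
point off `⋂ₖ σ^[k](X)` is `σ^[k] y` for a unique `k ∈ ℕ` and a unique `y` in the fundamental
domain `X ∖ σ(X)`. [cite: DeMichelisFreedman1992, §0 (p. 220), §2 (p. 223)] -/
theorem existsUnique_iterate_apply_eq (hinj : Injective σ) {x : X}
    (hx : x ∉ ⋂ k, range (σ^[k])) :
    ∃! p : ℕ × X, p.2 ∉ range σ ∧ σ^[p.1] p.2 = x := by
  classical
  have hex : ∃ k, x ∉ range (σ^[k]) := by simpa only [mem_iInter, not_forall] using hx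
  obtain ⟨k, hk, hmin⟩ : ∃ k, x ∉ range (σ^[k]) ∧ ∀ j < k, x ∈ range (σ^[j]) :=
    ⟨Nat.find hex, Nat.find_spec hex, fun j hj => not_not.1 (Nat.find_min hex hj)⟩
  have hk0 : k ≠ 0 := by
    rintro rfl
    exact hk ⟨x, rfl⟩
  obtain ⟨k, rfl⟩ := Nat.exists_eq_succ_of_ne_zero hk0
  obtain ⟨y, rfl⟩ := hmin k k.lt_succ_self
  have hy : y ∉ range σ := by
    rintro ⟨z, rfl⟩
    exact hk ⟨z, (Function.iterate_succ_apply σ k z).symm⟩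
  refine ⟨(k, y), ⟨hy, rfl⟩, ?_⟩
  rintro ⟨m, y'⟩ ⟨hy', h⟩
  dsimp only at hy' h
  rcases lt_trichotomy m k with hmk | rfl | hkm
  · obtain ⟨j, rfl⟩ := Nat.exists_eq_add_of_lt hmk
    exfalso
    apply hy'
    rw [show m + j + 1 = m + (j + 1) from add_assoc m j 1, Function.iterate_add_apply] at h
    refine ⟨σ^[j] y, ?_⟩
    rw [← Function.iterate_succ_apply' σ j y]
    exact (hinj.iterate m h).symm
  · exact Prod.ext rfl (hinj.iterate m h)
  · obtain ⟨j, rfl⟩ := Nat.exists_eq_add_of_lt hkm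
    exfalso
    apply hy
    rw [show k + j + 1 = k + (j + 1) from add_assoc k j 1, Function.iterate_add_apply] at h
    refine ⟨σ^[j] y', ?_⟩
    rw [← Function.iterate_succ_apply' σ j y']
    exact hinj.iterate k h

/-- **The `k`-th ring is `σ^[k]` of the fundamental domain**: `σ^[k](X ∖ σ(X)) = R⁴_k ∖ R⁴_{k+1}`
("`n` consecutive rings `R⁴ ∖ dⁿ(R⁴)`", §0; `R⁴_n ∖ R⁴_{n+1}`, §2), `σ` injective.
[cite: DeMichelisFreedman1992, §0 (p. 220), §2 (p. 223)] -/
theorem image_iterate_compl_range (hinj : Injective σ) (k : ℕ) :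
    σ^[k] '' (range σ)ᶜ = range (σ^[k]) \ range (σ^[k + 1]) := by
  apply Subset.antisymm
  · rintro _ ⟨y, hy, rfl⟩
    refine ⟨⟨y, rfl⟩, ?_⟩
    rintro ⟨z, hz⟩
    rw [Function.iterate_succ_apply] at hz
    exact hy ⟨z, hinj.iterate k hz⟩
  · rintro x ⟨⟨y, rfl⟩, hx⟩
    refine ⟨y, fun ⟨z, hz⟩ => hx ⟨z, ?_⟩, rfl⟩
    rw [Function.iterate_succ_apply, hz]

/-- **The rings cover the complement of the end compactum**:
`X ∖ ⋂ₖ R⁴_k = ⋃ₖ (R⁴_k ∖ R⁴_{k+1})`. [cite: DeMichelisFreedman1992, §0 (p. 220), §2 (p. 223)] -/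
theorem compl_iInter_range_iterate_eq_iUnion (hinj : Injective σ) :
    (⋂ k, range (σ^[k]))ᶜ = ⋃ k, range (σ^[k]) \ range (σ^[k + 1]) := by
  apply Subset.antisymm
  · intro x hx
    obtain ⟨⟨k, y⟩, ⟨hy, rfl⟩, -⟩ := existsUnique_iterate_apply_eq hinj hx
    rw [mem_iUnion]
    exact ⟨k, by rw [← image_iterate_compl_range hinj k]; exact ⟨y, hy, rfl⟩⟩
  · intro x hx hx'
    obtain ⟨k, -, hk⟩ := mem_iUnion.1 hx
    exact hk (mem_iInter.1 hx' (k + 1))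

/-- **Distinct rings are disjoint.** [cite: DeMichelisFreedman1992, §0 (p. 220)] -/
theorem disjoint_ring (σ : X → X) {k l : ℕ} (hkl : k ≠ l) :
    Disjoint (range (σ^[k]) \ range (σ^[k + 1])) (range (σ^[l]) \ range (σ^[l + 1])) := by
  wlog h : k < l generalizing k l
  · exact (this hkl.symm (lt_of_le_of_ne (not_lt.1 h) hkl.symm)).symm
  refine disjoint_left.2 fun x hxk hxl => hxk.2 ?_
  exact antitone_range_iterate σ (Nat.succ_le_of_lt h) hxl.1

/-- Two points of `C ∖ σ(C)` in the same orbit coincide (`σ` injective, `σ(X) ⊆ C`). [folklore] -/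
theorem eq_of_mem_diff_image_of_iterate_apply_eq (hinj : Injective σ) (hσC : range σ ⊆ C)
    {y y' : X} (hy : y ∈ C \ σ '' C) (hy' : y' ∈ C \ σ '' C) {m n : ℕ}
    (h : σ^[m] y = σ^[n] y') : y = y' := by
  rcases lt_trichotomy m n with hmn | rfl | hnm
  · obtain ⟨j, rfl⟩ := Nat.exists_eq_add_of_lt hmn
    exfalso
    apply hy.2
    rw [show m + j + 1 = m + (j + 1) from add_assoc m j 1, Function.iterate_add_apply] at h
    refine ⟨σ^[j] y', iterate_mem_of_mem hσC hy'.1 j, ?_⟩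
    rw [← Function.iterate_succ_apply' σ j y']
    exact (hinj.iterate m h).symm
  · exact hinj.iterate m h
  · obtain ⟨j, rfl⟩ := Nat.exists_eq_add_of_lt hnm
    exfalso
    apply hy'.2
    rw [show n + j + 1 = n + (j + 1) from add_assoc n j 1, Function.iterate_add_apply] at h
    refine ⟨σ^[j] y, iterate_mem_of_mem hσC hy.1 j, ?_⟩
    rw [← Function.iterate_succ_apply' σ j y]
    exact hinj.iterate n h

/-- **"`Y` can be described as `C ∖ d(C)/pt ∼ d(pt)`"** (§2, p. 223): for `σ` injective with
`σ(X) ⊆ C`, every orbit off the end compactum — two points being in the same orbit of the monoid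
action when some iterates of them agree — meets the compact fundamental domain `C ∖ σ(C)` in
exactly one point. [cite: DeMichelisFreedman1992, §2 (p. 223)] -/
theorem existsUnique_mem_diff_image (hinj : Injective σ) (hσC : range σ ⊆ C) {x : X}
    (hx : x ∉ ⋂ k, range (σ^[k])) :
    ∃! y, y ∈ C \ σ '' C ∧ ∃ m n : ℕ, σ^[m] x = σ^[n] y := by
  obtain ⟨⟨k, y₀⟩, ⟨hy₀, rfl⟩, -⟩ := existsUnique_iterate_apply_eq hinj hx
  dsimp only at hy₀ ⊢
  have hex : ∃ y, y ∈ C \ σ '' C ∧ ∃ m n : ℕ, σ^[m] (σ^[k] y₀) = σ^[n] y := by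
    by_cases hyC : y₀ ∈ C
    · exact ⟨y₀, ⟨hyC, fun ⟨c, _, hc⟩ => hy₀ ⟨c, hc⟩⟩, 0, k, rfl⟩
    · refine ⟨σ y₀, ⟨hσC ⟨y₀, rfl⟩, fun ⟨c, hc, hce⟩ => hyC (hinj hce ▸ hc)⟩, 1, k, ?_⟩
      rw [← Function.iterate_add_apply, add_comm, Function.iterate_add_apply]
      rfl
  obtain ⟨y, hy, m, n, hrel⟩ := hex
  refine ⟨y, ⟨hy, m, n, hrel⟩, fun y' ⟨hy', m', n', hrel'⟩ => ?_⟩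
  have h1 : σ^[m' + m] (σ^[k] y₀) = σ^[m' + n] y := by
    rw [Function.iterate_add_apply, hrel, ← Function.iterate_add_apply]
  have h2 : σ^[m + m'] (σ^[k] y₀) = σ^[m + n'] y' := by
    rw [Function.iterate_add_apply, hrel', ← Function.iterate_add_apply]
  rw [add_comm m' m, h2] at h1
  exact (eq_of_mem_diff_image_of_iterate_apply_eq hinj hσC hy hy' h1.symm).symm

/-- The compact fundamental domain `C ∖ σ(C)` lies in `C ∖ σ²(X)`. [folklore] -/
theorem diff_image_subset_diff_range_iterate_two (hσC : range σ ⊆ C) :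
    C \ σ '' C ⊆ C \ range (σ^[2]) := by
  rintro y ⟨hyC, hy⟩
  refine ⟨hyC, ?_⟩
  rintro ⟨z, rfl⟩
  exact hy ⟨σ z, hσC ⟨z, rfl⟩, rfl⟩

/-- `C ∖ σ²(X)` misses the end compactum. [folklore] -/
theorem diff_range_iterate_two_subset_compl (C : Set X) (σ : X → X) :
    C \ range (σ^[2]) ⊆ (⋂ k, range (σ^[k]))ᶜ :=
  fun _ hy hy' => hy.2 (mem_iInter.1 hy' 2)

/-! #### Topology: the end compactum is compact, the orbit space is covered by a compact set -/

variable [TopologicalSpace X]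

/-- **The end compactum `⋂ₖ R⁴_k = ⋂ₖ σ^[k](C)` is compact** (`C` compact, `σ` continuous, `X`
Hausdorff). [cite: DeMichelisFreedman1992, §0 (p. 220), §2 (p. 223)] -/
theorem isCompact_iInter_range_iterate [T2Space X] (hσ : Continuous σ) (hC : IsCompact C)
    (hσC : range σ ⊆ C) : IsCompact (⋂ k, range (σ^[k])) := by
  rw [iInter_range_iterate_eq hσC]
  refine hC.of_isClosed_subset (isClosed_iInter fun k => (hC.image (hσ.iterate k)).isClosed) ?_
  exact (iInter_subset _ 0).trans (by simp)

/-- The end compactum is closed. [folklore] -/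
theorem isClosed_iInter_range_iterate [T2Space X] (hσ : Continuous σ) (hC : IsCompact C)
    (hσC : range σ ⊆ C) : IsClosed (⋂ k, range (σ^[k])) :=
  (isCompact_iInter_range_iterate hσ hC hσC).isClosed

/-- Iterates of an open embedding are open embeddings. [folklore] -/
theorem isOpenEmbedding_iterate (hσ : IsOpenEmbedding σ) : ∀ k, IsOpenEmbedding (σ^[k])
  | 0 => IsOpenEmbedding.id
  | k + 1 => by
    rw [Function.iterate_succ]
    exact (isOpenEmbedding_iterate hσ k).comp hσ

/-- **The orbit space is covered by a compact set**: `C ∖ σ²(X)` — which contains the fundamental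
domain `C ∖ σ(C)` (`diff_image_subset_diff_range_iterate_two`) and misses the end compactum
(`diff_range_iterate_two_subset_compl`) — is compact when `C` is compact and `σ` is an open
embedding (so the quotient `Y` of §0/§2 is the continuous image of a compact set).
[cite: DeMichelisFreedman1992, §2 (p. 223)] -/
theorem isCompact_diff_range_iterate_two (hσ : IsOpenEmbedding σ) (hC : IsCompact C) :
    IsCompact (C \ range (σ^[2])) :=
  hC.diff (isOpenEmbedding_iterate hσ 2).isOpen_range

/-! #### Taubes' height function `τ` -/

/-- The push-forward of a compactly supported continuous function along an open embedding,
extended by zero, is continuous. [folklore] -/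
theorem continuous_extend_zero_of_isOpenEmbedding [T2Space X] {f : X → X}
    (hf : IsOpenEmbedding f) {ρ : X → ℝ} (hρ : Continuous ρ) (hρc : HasCompactSupport ρ) :
    Continuous (Function.extend f ρ 0) := by
  rw [continuous_iff_continuousAt]
  intro x
  by_cases hx : x ∈ range f
  · obtain ⟨a, rfl⟩ := hx
    rw [← hf.continuousAt_iff, Function.extend_comp hf.injective]
    exact hρ.continuousAt
  · have hK : IsCompact (f '' tsupport ρ) := hρc.image hf.continuous
    have hxK : x ∉ f '' tsupport ρ := fun ⟨a, _, ha⟩ => hx ⟨a, ha⟩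
    have hev : (fun _ => (0 : ℝ)) =ᶠ[𝓝 x] Function.extend f ρ 0 := by
      filter_upwards [hK.isClosed.isOpen_compl.mem_nhds hxK] with z hz
      by_cases hz' : ∃ a, f a = z
      · obtain ⟨a, rfl⟩ := hz'
        rw [hf.injective.extend_apply]
        exact (image_eq_zero_of_notMem_tsupport fun ha => hz ⟨a, ha, rfl⟩).symm
      · rw [Function.extend_apply' _ _ _ hz']
        rfl
    exact continuousAt_const.congr hev

/-- **Taubes' height function** ("Taubes [24] suggests introducing a proper function
`τ : M_∞ → ℝ₊` such that `τ(d(x)) = 1 + τ(x)`", §2, p. 223), on the end itself. Let `σ` be an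
open embedding of a locally compact Hausdorff space `X` into itself with `σ(X) ⊆ C`, `C`
compact. Then there is `τ : X → ℝ`, `τ ≥ 0`, continuous on the complement of the end compactum
`⋂ₖ σ^[k](X)`, with `τ (σ x) = τ x + 1` off the end compactum, `τ ≥ k` on `σ^[k](X)` minus the
end compactum and `τ ≤ k` off `σ^[k](X)` — so `k ≤ τ ≤ k + 1` on the `k`-th ring and `τ → ∞`
exactly towards the end compactum (properness in the direction of the end; in the source `M_∞`
is the end glued to a compact piece). Construction: `τ = Σₖ ρₖ`, `ρₖ` the push-forward along
`σ^[k]`, extended by zero, of a compactly supported continuous `ρ : X → [0, 1]` with `ρ = 1` on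
`C`; the sum is locally finite off the end compactum. [cite: DeMichelisFreedman1992, §2 (p. 223)] -/
theorem exists_height_function [T2Space X] [LocallyCompactSpace X] (hσ : IsOpenEmbedding σ)
    (hC : IsCompact C) (hσC : range σ ⊆ C) :
    ∃ τ : X → ℝ, ContinuousOn τ (⋂ k, range (σ^[k]))ᶜ ∧ (∀ x, 0 ≤ τ x) ∧
      (∀ x, x ∉ (⋂ k, range (σ^[k])) → τ (σ x) = τ x + 1) ∧
      (∀ (k : ℕ) (x : X), x ∉ (⋂ k, range (σ^[k])) → x ∈ range (σ^[k]) → (k : ℝ) ≤ τ x) ∧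
      (∀ (k : ℕ) (x : X), x ∉ range (σ^[k]) → τ x ≤ k) := by
  classical
  obtain ⟨ρ, hρ1, -, hρc, hρ01⟩ :=
    exists_continuous_one_zero_of_isCompact hC isClosed_empty (disjoint_empty C)
  have hinj : ∀ k, Injective (σ^[k]) := fun k => hσ.injective.iterate k
  -- the push-forwards `ρ_k` of `ρ` along the iterates, extended by zero
  obtain ⟨ρk, hρk_def⟩ : ∃ ρk : ℕ → X → ℝ, ∀ k, ρk k = Function.extend (σ^[k]) ρ 0 :=
    ⟨_, fun _ => rfl⟩
  have hρk_apply : ∀ k a, ρk k (σ^[k] a) = ρ a := fun k a => by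
    rw [hρk_def]
    exact (hinj k).extend_apply _ _ a
  have hρk_zero : ∀ k x, x ∉ range (σ^[k]) → ρk k x = 0 := fun k x hx => by
    rw [hρk_def, Function.extend_apply' _ _ _ (by simpa only [mem_range] using hx)]
    rfl
  have hρk_mem : ∀ k x, ρk k x ∈ Icc (0 : ℝ) 1 := fun k x => by
    by_cases hx : x ∈ range (σ^[k])
    · obtain ⟨a, rfl⟩ := hx
      rw [hρk_apply]
      exact hρ01 a
    · rw [hρk_zero k x hx]
      exact ⟨le_rfl, zero_le_one⟩
  have hρk_cont : ∀ k, Continuous (ρk k) := fun k => by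
    rw [hρk_def]
    exact continuous_extend_zero_of_isOpenEmbedding (isOpenEmbedding_iterate hσ k) ρ.continuous
      hρc
  have hρk_succ : ∀ k x, ρk (k + 1) (σ x) = ρk k x := fun k x => by
    by_cases hx : x ∈ range (σ^[k])
    · obtain ⟨a, rfl⟩ := hx
      rw [hρk_apply, ← Function.iterate_succ_apply' σ k a, hρk_apply]
    · rw [hρk_zero k x hx, hρk_zero]
      rintro ⟨a, ha⟩
      rw [Function.iterate_succ_apply'] at ha
      exact hx ⟨a, hσ.injective ha⟩
  have hρk_zero_apply : ∀ x, ρk 0 (σ x) = 1 := fun x => by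
    have := hρk_apply 0 (σ x)
    rw [Function.iterate_zero_apply] at this
    rw [this]
    exact hρ1 (hσC ⟨x, rfl⟩)
  -- off the end compactum only finitely many `ρ_k` are nonzero, locally uniformly
  have hvanish : ∀ (m k : ℕ) (z : X), z ∉ σ^[m] '' C → m < k → ρk k z = 0 := by
    intro m k z hz hmk
    apply hρk_zero
    obtain ⟨j, rfl⟩ := Nat.exists_eq_add_of_lt hmk
    intro hz'
    have h1 : z ∈ σ^[m + j] '' C := range_iterate_succ_subset_image hσC (m + j) hz'
    exact hz (antitone_image_iterate hσC (Nat.le_add_right m j) h1)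
  have hfin : ∀ x, x ∉ (⋂ k, range (σ^[k])) → ∃ m, x ∉ σ^[m] '' C := fun x hx => by
    rw [iInter_range_iterate_eq hσC] at hx
    simpa only [mem_iInter, not_forall] using hx
  have hsum_eq : ∀ (m : ℕ) (z : X), z ∉ σ^[m] '' C →
      ∑' k, ρk k z = ∑ k ∈ Finset.range (m + 1), ρk k z := fun m z hz =>
    tsum_eq_sum fun k hk => hvanish m k z hz (by simpa [Finset.mem_range, not_lt,
      Nat.succ_le_iff] using hk)
  obtain ⟨τ, hτ_def⟩ : ∃ τ : X → ℝ, ∀ x, τ x = ∑' k, ρk k x := ⟨_, fun _ => rfl⟩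
  have hτ_nonneg : ∀ x, 0 ≤ τ x := fun x => by
    rw [hτ_def]
    exact tsum_nonneg fun k => (hρk_mem k x).1
  have hcont : ContinuousOn τ (⋂ k, range (σ^[k]))ᶜ := by
    intro x hx
    obtain ⟨m, hm⟩ := hfin x hx
    have hU : (σ^[m] '' C)ᶜ ∈ 𝓝 x :=
      (hC.image (hσ.continuous.iterate m)).isClosed.isOpen_compl.mem_nhds hm
    have hev : (fun z => ∑ k ∈ Finset.range (m + 1), ρk k z) =ᶠ[𝓝 x] τ := by
      filter_upwards [hU] with z hz
      rw [hτ_def]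
      exact (hsum_eq m z hz).symm
    refine (ContinuousAt.congr ?_ hev).continuousWithinAt
    exact (continuous_finsetSum _ fun k _ => hρk_cont k).continuousAt
  have hshift : ∀ x, x ∉ (⋂ k, range (σ^[k])) → τ (σ x) = τ x + 1 := by
    intro x hx
    obtain ⟨m, hm⟩ := hfin x hx
    have hs : Summable fun k => ρk (k + 1) (σ x) := by
      simp_rw [hρk_succ]
      exact summable_of_ne_finset_zero (s := Finset.range (m + 1)) fun k hk =>
        hvanish m k x hm (by simpa [Finset.mem_range, not_lt, Nat.succ_le_iff] using hk)
    rw [hτ_def, hτ_def, tsum_eq_zero_add' hs]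
    simp_rw [hρk_succ, hρk_zero_apply]
    ring
  have hlower : ∀ (k : ℕ) (x : X), x ∉ (⋂ k, range (σ^[k])) → x ∈ range (σ^[k]) →
      (k : ℝ) ≤ τ x := by
    intro k
    induction k with
    | zero =>
      intro x _ _
      exact_mod_cast hτ_nonneg x
    | succ k ih =>
      rintro x hx ⟨y, rfl⟩
      rw [Function.iterate_succ_apply'] at hx ⊢
      have hy : σ^[k] y ∉ ⋂ k, range (σ^[k]) := fun h =>
        hx ((apply_mem_iInter_range_iterate_iff hσ.injective).2 h)
      rw [hshift _ hy]
      push_cast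
      linarith [ih (σ^[k] y) hy ⟨y, rfl⟩]
  have hupper : ∀ (k : ℕ) (x : X), x ∉ range (σ^[k]) → τ x ≤ k := by
    intro k x hx
    have h0 : ∀ j, j ∉ Finset.range k → ρk j x = 0 := fun j hj =>
      hρk_zero j x fun h => hx (antitone_range_iterate σ
        (by simpa [Finset.mem_range, not_lt] using hj) h)
    rw [hτ_def, tsum_eq_sum h0]
    calc ∑ j ∈ Finset.range k, ρk j x ≤ ∑ _j ∈ Finset.range k, (1 : ℝ) :=
          Finset.sum_le_sum fun j _ => (hρk_mem j x).2
      _ = k := by simp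
  exact ⟨τ, hcont, hτ_nonneg, hshift, hlower, hupper⟩

end EndPeriodic

/-! ### The polar family: the end produced by a diffeomorphism `(R⁴_s, K) ≅ (R⁴_t, K)` (§0 with p. 247) -/

section PolarEnd

variable {E : Type*} [NormedAddCommGroup E]
variable (R : Opens E) (e : R ≃ₜ E)

/-- The open polar ball `R⁴_s = {(1 - s) ‖e ·‖ < 1}` lies in the closed one
`{(1 - s) ‖e ·‖ ≤ 1}`. [folklore] -/
theorem polarBall_subset_setOf_mul_norm_le (s : ℝ) :
    (polarBall R e s : Set E) ⊆ {x | ∃ hx : x ∈ R, (1 - s) * ‖e ⟨x, hx⟩‖ ≤ 1} := fun _ hx =>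
  let ⟨hxR, h⟩ := (mem_polarBall R e).1 hx
  ⟨hxR, h.le⟩

/-- **The closed polar ball of parameter `s` lies in the open ball `R⁴_t` for `s < t`** (the
closed ball of `ρ`-radius `1/(1 - s)` inside the open ball of the larger radius `1/(1 - t)`;
"`R'⁴ ⊂ C ⊂ R⁴`", §2). [cite: DeMichelisFreedman1992, §2 (p. 222)] -/
theorem setOf_mul_norm_le_subset_polarBall {s t : ℝ} (hst : s < t) :
    {x : E | ∃ hx : x ∈ R, (1 - s) * ‖e ⟨x, hx⟩‖ ≤ 1} ⊆ polarBall R e t := by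
  rintro x ⟨hxR, h⟩
  refine (mem_polarBall R e).2 ⟨hxR, ?_⟩
  rcases (norm_nonneg (e ⟨x, hxR⟩)).eq_or_lt with h0 | hpos
  · rw [← h0, mul_zero]
    exact one_pos
  · calc (1 - t) * ‖e ⟨x, hxR⟩‖ < (1 - s) * ‖e ⟨x, hxR⟩‖ :=
          mul_lt_mul_of_pos_right (by linarith) hpos
      _ ≤ 1 := h

/-- **The closed polar ball `{(1 - s) ‖e ·‖ ≤ 1}`, `s < 1`, is compact** (it is the preimage
under the polar coordinates `e` of the closed ball of radius `1/(1 - s)` of the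
finite-dimensional — more generally proper — space `E`): the compact `C` of §2 for the polar
family. [cite: DeMichelisFreedman1992, §2 (p. 222)] -/
theorem isCompact_setOf_mul_norm_le [ProperSpace E] {s : ℝ} (hs : s < 1) :
    IsCompact {x : E | ∃ hx : x ∈ R, (1 - s) * ‖e ⟨x, hx⟩‖ ≤ 1} := by
  have h1 : IsCompact {y : E | (1 - s) * ‖y‖ ≤ 1} := by
    have : {y : E | (1 - s) * ‖y‖ ≤ 1} = Metric.closedBall 0 (1 / (1 - s)) := by
      ext y
      rw [mem_setOf_eq, Metric.mem_closedBall, dist_zero_right, le_div_iff₀ (by linarith),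
        mul_comm]
    rw [this]
    exact isCompact_closedBall _ _
  have h3 := (e.isCompact_preimage.2 h1).image continuous_subtype_val
  convert h3 using 1
  ext x
  constructor
  · rintro ⟨hx, h⟩
    exact ⟨⟨x, hx⟩, h, rfl⟩
  · rintro ⟨y, hy, rfl⟩
    exact ⟨y.2, hy⟩

/-- The closed polar ball of parameter `s < t`, `s < 1`, as a compact subset of the open ball
`R⁴_t` (with its subspace topology). [cite: DeMichelisFreedman1992, §2 (p. 222)] -/
theorem isCompact_preimage_val_setOf_mul_norm_le [ProperSpace E] {s t : ℝ} (hst : s < t)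
    (hs : s < 1) :
    IsCompact ((Subtype.val : polarBall R e t → E) ⁻¹'
      {x : E | ∃ hx : x ∈ R, (1 - s) * ‖e ⟨x, hx⟩‖ ≤ 1}) := by
  rw [Subtype.isCompact_iff, image_preimage_eq_inter_range, Subtype.range_coe_subtype]
  convert isCompact_setOf_mul_norm_le R e hs using 1
  refine inter_eq_left.2 fun x hx => ?_
  exact setOf_mul_norm_le_subset_polarBall R e hst hx

variable {R e}

section

variable [NormedSpace ℝ E] {s t : ℝ} (hst : s ≤ t)
  (d : polarBall R e s ≃ₘ⟮𝓘(ℝ, E), 𝓘(ℝ, E)⟯ polarBall R e t)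

/-- **The self-map `σ = incl ∘ d⁻¹` of `R⁴_t` is an open embedding** (`d : R⁴_s ≅ R⁴_t` a
diffeomorphism, `R⁴_s ⊆ R⁴_t`; the source's `d : R⁴ → R'⁴ ⊂ R⁴`).
[cite: DeMichelisFreedman1992, §0 (p. 220), §2 (pp. 222–223)] -/
theorem isOpenEmbedding_inclusion_comp_symm :
    IsOpenEmbedding (Opens.inclusion (polarBall_mono R e hst) ∘ d.symm) :=
  (Opens.isOpenEmbedding_of_le (polarBall_mono R e hst)).comp d.symm.toHomeomorph.isOpenEmbedding

/-- The self-map `σ = incl ∘ d⁻¹` of `R⁴_t` is smooth (for the smooth structures by restriction).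
[cite: DeMichelisFreedman1992, §2 (pp. 222–223)] -/
theorem contMDiff_inclusion_comp_symm :
    ContMDiff 𝓘(ℝ, E) 𝓘(ℝ, E) ∞ (Opens.inclusion (polarBall_mono R e hst) ∘ d.symm) :=
  (contMDiff_inclusion (polarBall_mono R e hst)).comp d.symm.contMDiff

/-- The image of `σ = incl ∘ d⁻¹` is `R⁴_s` ("`d : R⁴ → R'⁴`" onto, §2).
[cite: DeMichelisFreedman1992, §2 (pp. 222–223)] -/
theorem range_inclusion_comp_symm :
    range (Opens.inclusion (polarBall_mono R e hst) ∘ d.symm) =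
      {x : polarBall R e t | (x : E) ∈ polarBall R e s} := by
  rw [Set.range_comp, EquivLike.range_eq_univ, image_univ]
  exact Set.range_inclusion _

/-- `σ = incl ∘ d⁻¹` has the same underlying points as `d⁻¹`. [folklore] -/
theorem coe_inclusion_comp_symm_apply (x : polarBall R e t) :
    ((Opens.inclusion (polarBall_mono R e hst) ∘ d.symm) x : E) = d.symm x :=
  rfl

/-- The image `R⁴_s` of `σ` lies in the closed polar ball of parameter `s` ("`R'⁴ ⊂ C`", §2).
[cite: DeMichelisFreedman1992, §2 (p. 222)] -/
theorem range_inclusion_comp_symm_subset :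
    range (Opens.inclusion (polarBall_mono R e hst) ∘ d.symm) ⊆
      (Subtype.val : polarBall R e t → E) ⁻¹'
        {x : E | ∃ hx : x ∈ R, (1 - s) * ‖e ⟨x, hx⟩‖ ≤ 1} := by
  rw [range_inclusion_comp_symm hst d]
  exact fun x hx => polarBall_subset_setOf_mul_norm_le R e s hx

/-- **`σ` fixes every point that `d` fixes**: if `d` is the identity on `K` ("diffeomorphic
relative to the identity on `K`, `(d, id_K)`", §0, p. 247), then so is `σ = incl ∘ d⁻¹`.
[cite: DeMichelisFreedman1992, §0 (p. 220); proof of Thm. 4.1, p. 247] -/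
theorem inclusion_comp_symm_apply_of_apply_eq {K : Set E}
    (hd : ∀ x : polarBall R e s, (x : E) ∈ K → ((d x : polarBall R e t) : E) = x)
    (x : polarBall R e t) (hxK : (x : E) ∈ K) (hxs : (x : E) ∈ polarBall R e s) :
    (Opens.inclusion (polarBall_mono R e hst) ∘ d.symm) x = x := by
  set y : polarBall R e s := ⟨x, hxs⟩ with hy
  have h1 : d y = x := Subtype.ext (hd y hxK)
  have h2 : d.symm x = y := by rw [← h1, Diffeomorph.symm_apply_apply]
  apply Subtype.ext
  show ((d.symm x : polarBall R e s) : E) = x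
  rw [h2]

end

/-- **The end-periodic end of §0/§2 from a diffeomorphism `(R⁴_s, K) → (R⁴_t, K)` relative to the
identity on `K`, `s < t`** (the first move of the first paragraph of the proof of Thm. 4.1,
p. 247: "Suppose there is a diffeomorphism `(d, id_K) : (R⁴_s, K) → (R⁴_t, K)` … As in the
introduction, this allows the construction of end periodic metrics", short of the metrics). Let
`R ⊆ E` be open with polar coordinates `e : R ≃ₜ E` (`E` a finite-dimensional real normed
space, in the tree `ℝ⁴`), `K ⊂ R⁴_0`, `0 ≤ s < t`, `s < 1`, and `d : R⁴_s ≅ R⁴_t` a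
diffeomorphism with `d = id` on `K`. Then the self-map `σ = incl ∘ d⁻¹` of `X = R⁴_t` is a
smooth open embedding with image `R⁴_s`, fixing `K` pointwise, and generates the end of §0/§2:
the end compactum `⋂ₖ σ^[k](X)` ("`⋂ₙ dⁿ(R⁴_t)`") is compact and contains `K`; off it every
point is `σ^[k] y` for a unique `k` and a unique `y` in the fundamental domain `X ∖ σ(X)` (the
covering action by the monoid `{σ, σ², …}`, whose orbits are the rings `σ^[k](X ∖ σ(X))`); every
orbit meets the compact fundamental domain `C ∖ σ(C)`, `C = {(1 - s) ‖e ·‖ ≤ 1}` the closed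
polar ball, exactly once ("`Y` can be described as `C ∖ d(C)/pt ∼ d(pt)`"); and Taubes' height
function `τ` exists (`τ ∘ σ = τ + 1`, `k ≤ τ ≤ k + 1` on the `k`-th ring). What the source does
next with this end — the smooth orbit space `Y`, the metrics `B_n`, `Q_n`, `B_∞ ≅ Q_∞` and
`Φ(B) = Φ(B_∞) = Φ(Q_∞) = Φ(Q)` via Thm. 2.1 — is not formalized.
[cite: DeMichelisFreedman1992, §0 (p. 220); §2 (pp. 222–223); proof of Thm. 4.1, p. 247] -/
theorem exists_endPeriodicEnd_of_diffeomorph [NormedSpace ℝ E] [ProperSpace E] {K : Set E}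
    (hK0 : K ⊆ polarBall R e 0) {s t : ℝ} (hs0 : 0 ≤ s) (hst : s < t) (hs1 : s < 1)
    (d : polarBall R e s ≃ₘ⟮𝓘(ℝ, E), 𝓘(ℝ, E)⟯ polarBall R e t)
    (hd : ∀ x : polarBall R e s, (x : E) ∈ K → ((d x : polarBall R e t) : E) = x) :
    ∃ σ : polarBall R e t → polarBall R e t,
      (∀ x, (σ x : E) = d.symm x) ∧ IsOpenEmbedding σ ∧ ContMDiff 𝓘(ℝ, E) 𝓘(ℝ, E) ∞ σ ∧
      range σ = {x : polarBall R e t | (x : E) ∈ polarBall R e s} ∧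
      (∀ x : polarBall R e t, (x : E) ∈ K → σ x = x) ∧
      IsCompact (⋂ k, range (σ^[k])) ∧
      (∀ x : polarBall R e t, (x : E) ∈ K → x ∈ ⋂ k, range (σ^[k])) ∧
      (∀ x, x ∉ (⋂ k, range (σ^[k])) →
        ∃! p : ℕ × polarBall R e t, p.2 ∉ range σ ∧ σ^[p.1] p.2 = x) ∧
      (∀ x, x ∉ (⋂ k, range (σ^[k])) →
        ∃! y : polarBall R e t, y ∈ (Subtype.val ⁻¹' {z : E | ∃ hz : z ∈ R,
            (1 - s) * ‖e ⟨z, hz⟩‖ ≤ 1}) \ σ '' (Subtype.val ⁻¹' {z : E | ∃ hz : z ∈ R,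
            (1 - s) * ‖e ⟨z, hz⟩‖ ≤ 1}) ∧
          ∃ m n : ℕ, σ^[m] x = σ^[n] y) ∧
      ∃ τ : polarBall R e t → ℝ, ContinuousOn τ (⋂ k, range (σ^[k]))ᶜ ∧ (∀ x, 0 ≤ τ x) ∧
        (∀ x, x ∉ (⋂ k, range (σ^[k])) → τ (σ x) = τ x + 1) ∧
        (∀ (k : ℕ) (x : polarBall R e t), x ∉ (⋂ k, range (σ^[k])) → x ∈ range (σ^[k]) →
          (k : ℝ) ≤ τ x) ∧
        (∀ (k : ℕ) (x : polarBall R e t), x ∉ range (σ^[k]) → τ x ≤ k) := by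
  set σ := Opens.inclusion (polarBall_mono R e hst.le) ∘ d.symm with hσ_def
  have hσ : IsOpenEmbedding σ := isOpenEmbedding_inclusion_comp_symm hst.le d
  have hC := isCompact_preimage_val_setOf_mul_norm_le R e hst hs1
  have hσC := range_inclusion_comp_symm_subset hst.le d
  have hKs : K ⊆ polarBall R e s := hK0.trans (polarBall_mono R e hs0)
  have hfix : ∀ x : polarBall R e t, (x : E) ∈ K → σ x = x := fun x hx =>
    inclusion_comp_symm_apply_of_apply_eq hst.le d hd x hx (hKs hx)
  haveI : LocallyCompactSpace (polarBall R e t) := (polarBall R e t).isOpen.locallyCompactSpace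
  obtain ⟨τ, hτ⟩ := EndPeriodic.exists_height_function hσ hC hσC
  exact ⟨σ, fun x => rfl, hσ, contMDiff_inclusion_comp_symm hst.le d,
    range_inclusion_comp_symm hst.le d, hfix,
    EndPeriodic.isCompact_iInter_range_iterate hσ.continuous hC hσC,
    fun x hx => EndPeriodic.mem_iInter_range_iterate_of_apply_eq (hfix x hx),
    fun x hx => EndPeriodic.existsUnique_iterate_apply_eq hσ.injective hx,
    fun x hx => EndPeriodic.existsUnique_mem_diff_image hσ.injective hσC hx, τ, hτ⟩

/-- **The same for parameters `s < t` in the Cantor set** — the setting of the tree's reduction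
`deMichelisFreedman1992_continuum_of_polar_nhdNogo` (whose hypothesis denies, for `s < t ∈ CS`,
a diffeomorphism `R⁴_s ≅ R⁴_t` equal to the identity near `K`, a fortiori on `K`): `CS ⊆ [0, 1]`
gives `0 ≤ s` and `s < t ≤ 1`. [cite: DeMichelisFreedman1992, §0 (p. 220); proof of Thm. 4.1, p. 247] -/
theorem exists_endPeriodicEnd_of_diffeomorph_cantorSet [NormedSpace ℝ E] [ProperSpace E]
    {K : Set E} (hK0 : K ⊆ polarBall R e 0) {s t : cantorSet} (hst : s < t)
    (d : polarBall R e (s : ℝ) ≃ₘ⟮𝓘(ℝ, E), 𝓘(ℝ, E)⟯ polarBall R e (t : ℝ))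
    (hd : ∀ x : polarBall R e (s : ℝ), (x : E) ∈ K →
      ((d x : polarBall R e (t : ℝ)) : E) = x) :
    ∃ σ : polarBall R e (t : ℝ) → polarBall R e (t : ℝ),
      (∀ x, (σ x : E) = d.symm x) ∧ IsOpenEmbedding σ ∧ ContMDiff 𝓘(ℝ, E) 𝓘(ℝ, E) ∞ σ ∧
      range σ = {x : polarBall R e (t : ℝ) | (x : E) ∈ polarBall R e (s : ℝ)} ∧
      (∀ x : polarBall R e (t : ℝ), (x : E) ∈ K → σ x = x) ∧
      IsCompact (⋂ k, range (σ^[k])) ∧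
      (∀ x : polarBall R e (t : ℝ), (x : E) ∈ K → x ∈ ⋂ k, range (σ^[k])) ∧
      (∀ x, x ∉ (⋂ k, range (σ^[k])) →
        ∃! p : ℕ × polarBall R e (t : ℝ), p.2 ∉ range σ ∧ σ^[p.1] p.2 = x) ∧
      (∀ x, x ∉ (⋂ k, range (σ^[k])) →
        ∃! y : polarBall R e (t : ℝ), y ∈ (Subtype.val ⁻¹' {z : E | ∃ hz : z ∈ R,
            (1 - (s : ℝ)) * ‖e ⟨z, hz⟩‖ ≤ 1}) \ σ '' (Subtype.val ⁻¹' {z : E | ∃ hz : z ∈ R,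
            (1 - (s : ℝ)) * ‖e ⟨z, hz⟩‖ ≤ 1}) ∧
          ∃ m n : ℕ, σ^[m] x = σ^[n] y) ∧
      ∃ τ : polarBall R e (t : ℝ) → ℝ, ContinuousOn τ (⋂ k, range (σ^[k]))ᶜ ∧ (∀ x, 0 ≤ τ x) ∧
        (∀ x, x ∉ (⋂ k, range (σ^[k])) → τ (σ x) = τ x + 1) ∧
        (∀ (k : ℕ) (x : polarBall R e (t : ℝ)), x ∉ (⋂ k, range (σ^[k])) →
          x ∈ range (σ^[k]) → (k : ℝ) ≤ τ x) ∧
        (∀ (k : ℕ) (x : polarBall R e (t : ℝ)), x ∉ range (σ^[k]) → τ x ≤ k) := by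
  have hs := cantorSet_subset_unitInterval s.2
  have ht := cantorSet_subset_unitInterval t.2
  have hst' : (s : ℝ) < t := hst
  exact exists_endPeriodicEnd_of_diffeomorph hK0 hs.1 hst' (lt_of_lt_of_le hst' ht.2) d hd

end PolarEnd

end Literature.Barriers.SmoothPoincare4

end
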